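import Mathlib
import Summits.Ventures.HodgeRepro.Tier3PadicPrincipalUnits

/-!
# Tier 3 (T3.2 / T3.5) — Serre's Proposition 8, the passage to the limit, I: `a ↦ (1 + p)^a`
on `ℤ_p` (`p` odd) — construction, homomorphism, injectivity

The one step of proofs/t3-p3/R2-PINNING-ADDENDUM-4.md §A25 (3)(c) that v1.9 left «on the page»:
«only the passage to the limit θ : ℤ_p = lim ℤ/p^{n−1} ≅ U_1 = lim U_1/U_n stays on the page».
Serre, A Course in Arithmetic (GTM 7, 1973), Ch. II §3.2 Proposition 8: «If p ≠ 2, U_1 is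
isomorphic to Z_p» — proved there by `x ↦ α^x` with `α = 1 + p`, extended from `ℤ` to `ℤ_p` by
continuity. Here, on the kernel (`p` an odd prime, `α = 1 + p`):

* `approxPow a n = (1 + p) ^ (appr a n)` (`PadicInt.appr a n < pⁿ` the `n`-th approximant of `a`);
  `(1 + p) ^ k ≡ (1 + p) ^ l (mod p ^ (n+1))` whenever `pⁿ ∣ k − l` (`pow_sub_pow_mem_span_of_dvd`,
  from the landed `one_add_prime_pow_pow_sub_one_mem_span`), so `approxPow a` is Cauchy and
  `padicExp a := lim_n approxPow a n` exists (`ℤ_p` complete);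
* `padicExp a ≡ approxPow a n (mod p ^ (n+1))` for every `n` (`padicExp_sub_approxPow_mem_span`),
  hence `padicExp a ∈ 1 + pℤ_p` (`dvd_padicExp_sub_one`), `padicExp (a + b) = padicExp a * padicExp b`
  (`padicExp_add`), `padicExp 0 = 1`;
* INJECTIVE (`padicExp_injective`): for `a ≠ 0` with `v_p(a) = m`, lifting the exponent
  (`emultiplicity_pow_sub_pow`, landed) gives `v_p((1 + p) ^ (appr a n) − 1) = m + 1` for `n > m`,
  so `padicExp a ≢ 1 (mod p ^ (m+2))` (`padicExp_ne_one_of_ne_zero`).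

The companion module `Tier3PadicExpLimitInverse` proves surjectivity onto `1 + pℤ_p` (the inverse
`padicLog`), continuity, and packages `padicExpEquiv : Multiplicative ℤ_[p] ≃* principalUnits p`.

Imports: Mathlib + the cell's `Tier3PadicPrincipalUnits` (v2) only; definitions: `approxPow`,
`padicExp` (noncomputable); no instance; no axiom beyond the standard three.
-/
namespace Summit.Ventures.HodgeRepro.T3.PadicExpLimit

open Summit.Ventures.HodgeRepro.T3.PadicPrincipalUnits Filter Topology

section Congruences

variable (p : ℕ) [hp : Fact p.Prime]

/-- `(1 + p) ^ (pⁿ j) ≡ 1 (mod p ^ (n+1))`. -/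
theorem pow_mul_sub_one_mem_span (hp1 : Odd p) (n j : ℕ) :
    (1 + p : ℤ_[p]) ^ (p ^ n * j) - 1 ∈ Ideal.span {(p : ℤ_[p]) ^ (n + 1)} := by
  have h := one_add_prime_pow_pow_sub_one_mem_span p hp1 n
  rw [Ideal.mem_span_singleton] at h ⊢
  rw [pow_mul]
  exact dvd_trans h (sub_one_dvd_pow_sub_one _ j)

/-- If `pⁿ ∣ k − l` (`l ≤ k`) then `(1 + p) ^ k ≡ (1 + p) ^ l (mod p ^ (n+1))`: the class of
`1 + p` in `U_1/U_{n+1}` has order dividing `pⁿ`. -/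
theorem pow_sub_pow_mem_span_of_dvd (hp1 : Odd p) {k l n : ℕ} (hlk : l ≤ k)
    (h : p ^ n ∣ k - l) :
    (1 + p : ℤ_[p]) ^ k - (1 + p : ℤ_[p]) ^ l ∈ Ideal.span {(p : ℤ_[p]) ^ (n + 1)} := by
  obtain ⟨j, hj⟩ := h
  have hk : k = p ^ n * j + l := Nat.eq_add_of_sub_eq hlk hj
  rw [hk, pow_add (1 + (p : ℤ_[p])) (p ^ n * j) l, ← sub_one_mul]
  exact Ideal.mul_mem_right _ _ (pow_mul_sub_one_mem_span p hp1 n j)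

/-- The same with an integer divisibility `pⁿ ∣ k − l` (no order on `k`, `l`). -/
theorem pow_sub_pow_mem_span_of_int_dvd (hp1 : Odd p) {k l n : ℕ}
    (h : (p : ℤ) ^ n ∣ (k : ℤ) - l) :
    (1 + p : ℤ_[p]) ^ k - (1 + p : ℤ_[p]) ^ l ∈ Ideal.span {(p : ℤ_[p]) ^ (n + 1)} := by
  rcases le_total l k with hlk | hkl
  · apply pow_sub_pow_mem_span_of_dvd p hp1 hlk
    have h' : ((p ^ n : ℕ) : ℤ) ∣ ((k - l : ℕ) : ℤ) := by
      rw [Nat.cast_sub hlk, Nat.cast_pow]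
      exact h
    exact Int.natCast_dvd_natCast.mp h'
  · have h' : ((p ^ n : ℕ) : ℤ) ∣ ((l - k : ℕ) : ℤ) := by
      rw [Nat.cast_sub hkl, Nat.cast_pow, ← neg_sub]
      exact (dvd_neg).mpr h
    have := pow_sub_pow_mem_span_of_dvd p hp1 hkl (Int.natCast_dvd_natCast.mp h')
    rw [← neg_sub]
    exact neg_mem this

/-- A natural number `k` with `(k : ℤ_p) ∈ pⁿℤ_p` is divisible by `pⁿ`. -/
theorem nat_dvd_of_mem_span {k n : ℕ} (h : (k : ℤ_[p]) ∈ Ideal.span {(p : ℤ_[p]) ^ n}) :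
    p ^ n ∣ k := by
  have h1 : ‖((k : ℤ) : ℤ_[p])‖ ≤ (p : ℝ) ^ (-n : ℤ) := by
    rw [PadicInt.norm_le_pow_iff_mem_span_pow, Int.cast_natCast]
    exact h
  have h2 := PadicInt.norm_int_le_pow_iff_dvd.mp h1
  rw [← Nat.cast_pow] at h2
  exact Int.natCast_dvd_natCast.mp h2

/-- Conversely. -/
theorem mem_span_of_nat_dvd {k n : ℕ} (h : p ^ n ∣ k) :
    (k : ℤ_[p]) ∈ Ideal.span {(p : ℤ_[p]) ^ n} := by
  rw [Ideal.mem_span_singleton]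
  have := Nat.cast_dvd_cast (α := ℤ_[p]) h
  rwa [Nat.cast_pow] at this

/-- Two naturals congruent in `ℤ_p` modulo `pⁿ` are congruent in `ℤ` modulo `pⁿ`. -/
theorem int_dvd_of_sub_mem_span {k l n : ℕ}
    (h : (k : ℤ_[p]) - (l : ℤ_[p]) ∈ Ideal.span {(p : ℤ_[p]) ^ n}) :
    (p : ℤ) ^ n ∣ (k : ℤ) - l := by
  have h1 : ‖(((k : ℤ) - l : ℤ) : ℤ_[p])‖ ≤ (p : ℝ) ^ (-n : ℤ) := by
    rw [PadicInt.norm_le_pow_iff_mem_span_pow]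
    push_cast
    exact h
  exact PadicInt.norm_int_le_pow_iff_dvd.mp h1

/-- `x ∈ pⁿℤ_p ⇒ ‖x‖ ≤ p^{−n}`. -/
theorem norm_le_of_mem_span {x : ℤ_[p]} {n : ℕ} (h : x ∈ Ideal.span {(p : ℤ_[p]) ^ n}) :
    ‖x‖ ≤ (p : ℝ) ^ (-n : ℤ) :=
  (PadicInt.norm_le_pow_iff_mem_span_pow x n).mpr h

/-- `pⁿ⁺¹ℤ_p ⊆ pⁿℤ_p`, and generally `pᵐℤ_p ⊆ pⁿℤ_p` for `n ≤ m`. -/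
theorem span_pow_le_span_pow {m n : ℕ} (hnm : n ≤ m) :
    Ideal.span {(p : ℤ_[p]) ^ m} ≤ Ideal.span {(p : ℤ_[p]) ^ n} :=
  Ideal.span_singleton_le_span_singleton.mpr (pow_dvd_pow _ hnm)

/-- The set of `x` with `x − c ∈ pⁿℤ_p` is closed. -/
theorem isClosed_sub_mem_span (c : ℤ_[p]) (n : ℕ) :
    IsClosed {x : ℤ_[p] | x - c ∈ Ideal.span {(p : ℤ_[p]) ^ n}} := by
  have : {x : ℤ_[p] | x - c ∈ Ideal.span {(p : ℤ_[p]) ^ n}} =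
      {x | ‖x - c‖ ≤ (p : ℝ) ^ (-n : ℤ)} := by
    ext x
    simp only [Set.mem_setOf_eq, PadicInt.norm_le_pow_iff_mem_span_pow]
  rw [this]
  exact isClosed_le ((continuous_id.sub continuous_const).norm) continuous_const

/-- `p^{−n} → 0`. -/
theorem tendsto_pow_neg : Tendsto (fun n : ℕ => (p : ℝ) ^ (-(n : ℤ))) atTop (𝓝 0) := by
  have hp0 : (0 : ℝ) ≤ (p : ℝ)⁻¹ := by positivity
  have hp1 : (p : ℝ)⁻¹ < 1 := inv_lt_one_of_one_lt₀ (by exact_mod_cast hp.out.one_lt)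
  refine (tendsto_pow_atTop_nhds_zero_of_lt_one hp0 hp1).congr fun n => ?_
  rw [zpow_neg, zpow_natCast, inv_pow]

/-- `p^{−(n+1)} → 0`. -/
theorem tendsto_pow_neg_succ :
    Tendsto (fun n : ℕ => (p : ℝ) ^ (-((n + 1 : ℕ) : ℤ))) atTop (𝓝 0) :=
  (tendsto_pow_neg p).comp (tendsto_add_atTop_nat 1)

end Congruences

section Limit

variable (p : ℕ) [hp : Fact p.Prime]

/-- The `n`-th approximant `(1 + p) ^ (appr a n)` of Serre's `α^a`, `α = 1 + p`. -/
noncomputable def approxPow (a : ℤ_[p]) (n : ℕ) : ℤ_[p] := (1 + p : ℤ_[p]) ^ (a.appr n)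

/-- `approxPow a 0 = 1`. -/
theorem approxPow_zero (a : ℤ_[p]) : approxPow p a 0 = 1 := by
  simp [approxPow, PadicInt.appr]

/-- `approxPow a m ≡ approxPow a n (mod p ^ (n+1))` for `n ≤ m`. -/
theorem approxPow_sub_mem_span (hp1 : Odd p) (a : ℤ_[p]) {m n : ℕ} (hnm : n ≤ m) :
    approxPow p a m - approxPow p a n ∈ Ideal.span {(p : ℤ_[p]) ^ (n + 1)} :=
  pow_sub_pow_mem_span_of_dvd p hp1 (PadicInt.appr_mono a hnm)
    (PadicInt.dvd_appr_sub_appr a n m hnm)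

/-- `dist (approxPow a m) (approxPow a n) ≤ p^{−(n+1)}` for `n ≤ m`. -/
theorem dist_approxPow_le (hp1 : Odd p) (a : ℤ_[p]) {m n : ℕ} (hnm : n ≤ m) :
    dist (approxPow p a m) (approxPow p a n) ≤ (p : ℝ) ^ (-((n + 1 : ℕ) : ℤ)) := by
  rw [dist_eq_norm]
  exact norm_le_of_mem_span p (approxPow_sub_mem_span p hp1 a hnm)

/-- The approximants form a Cauchy sequence. -/
theorem cauchySeq_approxPow (hp1 : Odd p) (a : ℤ_[p]) : CauchySeq (approxPow p a) := by
  refine cauchySeq_of_le_tendsto_0 (fun N : ℕ => (p : ℝ) ^ (-((N + 1 : ℕ) : ℤ)))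
    (fun n m N hNn hNm => ?_) (tendsto_pow_neg_succ p)
  have h1 : (1 : ℝ) ≤ p := by exact_mod_cast hp.out.one_lt.le
  rcases le_total n m with hnm | hmn
  · calc dist (approxPow p a n) (approxPow p a m)
        = dist (approxPow p a m) (approxPow p a n) := dist_comm _ _
      _ ≤ (p : ℝ) ^ (-((n + 1 : ℕ) : ℤ)) := dist_approxPow_le p hp1 a hnm
      _ ≤ (p : ℝ) ^ (-((N + 1 : ℕ) : ℤ)) := zpow_le_zpow_right₀ h1 (by omega)
  · calc dist (approxPow p a n) (approxPow p a m)
        ≤ (p : ℝ) ^ (-((m + 1 : ℕ) : ℤ)) := dist_approxPow_le p hp1 a hmn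
      _ ≤ (p : ℝ) ^ (-((N + 1 : ℕ) : ℤ)) := zpow_le_zpow_right₀ h1 (by omega)

/-- Serre's `α^a` for `a ∈ ℤ_p`, `α = 1 + p`: the limit of the approximants. -/
noncomputable def padicExp (a : ℤ_[p]) : ℤ_[p] := limUnder atTop (approxPow p a)

/-- The approximants converge to `padicExp a`. -/
theorem tendsto_approxPow (hp1 : Odd p) (a : ℤ_[p]) :
    Tendsto (approxPow p a) atTop (𝓝 (padicExp p a)) :=
  (cauchySeq_approxPow p hp1 a).tendsto_limUnder

/-- `padicExp a ≡ approxPow a n (mod p ^ (n+1))` for every `n`. -/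
theorem padicExp_sub_approxPow_mem_span (hp1 : Odd p) (a : ℤ_[p]) (n : ℕ) :
    padicExp p a - approxPow p a n ∈ Ideal.span {(p : ℤ_[p]) ^ (n + 1)} :=
  (isClosed_sub_mem_span p (approxPow p a n) (n + 1)).mem_of_tendsto (tendsto_approxPow p hp1 a)
    (eventually_atTop.mpr ⟨n, fun _ hm => approxPow_sub_mem_span p hp1 a hm⟩)

/-- `padicExp a ≡ 1 (mod p)`: the values are principal units. -/
theorem dvd_padicExp_sub_one (hp1 : Odd p) (a : ℤ_[p]) : (p : ℤ_[p]) ∣ padicExp p a - 1 := by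
  have h := padicExp_sub_approxPow_mem_span p hp1 a 0
  rw [approxPow_zero, zero_add, pow_one, Ideal.mem_span_singleton] at h
  exact h

/-- `padicExp a` is a unit of `ℤ_p`. -/
theorem isUnit_padicExp (hp1 : Odd p) (a : ℤ_[p]) : IsUnit (padicExp p a) :=
  isUnit_of_not_dvd p (not_dvd_of_dvd_sub_one p (dvd_padicExp_sub_one p hp1 a))

/-- `appr (a + b) n ≡ appr a n + appr b n (mod pⁿ)` in `ℤ`. -/
theorem int_dvd_appr_add (a b : ℤ_[p]) (n : ℕ) :
    (p : ℤ) ^ n ∣ ((a + b).appr n : ℤ) - ((a.appr n + b.appr n : ℕ) : ℤ) := by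
  apply int_dvd_of_sub_mem_span p
  have h1 := PadicInt.appr_spec n (a + b)
  have h2 := PadicInt.appr_spec n a
  have h3 := PadicInt.appr_spec n b
  have : ((a + b).appr n : ℤ_[p]) - ((a.appr n + b.appr n : ℕ) : ℤ_[p]) =
      (a - a.appr n) + (b - b.appr n) - ((a + b) - (a + b).appr n) := by
    push_cast
    ring
  rw [this]
  exact Ideal.sub_mem _ (Ideal.add_mem _ h2 h3) h1

/-- `approxPow (a + b) n ≡ approxPow a n * approxPow b n (mod p ^ (n+1))`. -/
theorem approxPow_add_sub_mul_mem_span (hp1 : Odd p) (a b : ℤ_[p]) (n : ℕ) :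
    approxPow p (a + b) n - approxPow p a n * approxPow p b n ∈
      Ideal.span {(p : ℤ_[p]) ^ (n + 1)} := by
  unfold approxPow
  rw [← pow_add]
  exact pow_sub_pow_mem_span_of_int_dvd p hp1 (int_dvd_appr_add p a b n)

/-- `padicExp (a + b) = padicExp a * padicExp b`. -/
theorem padicExp_add (hp1 : Odd p) (a b : ℤ_[p]) :
    padicExp p (a + b) = padicExp p a * padicExp p b := by
  have h1 : Tendsto (fun n => approxPow p a n * approxPow p b n) atTop
      (𝓝 (padicExp p a * padicExp p b)) :=
    (tendsto_approxPow p hp1 a).mul (tendsto_approxPow p hp1 b)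
  have h2 : Tendsto (approxPow p (a + b)) atTop (𝓝 (padicExp p a * padicExp p b)) := by
    refine h1.congr_dist (squeeze_zero (fun n => dist_nonneg) (fun n => ?_)
      (tendsto_pow_neg_succ p))
    rw [dist_comm, dist_eq_norm]
    exact norm_le_of_mem_span p (approxPow_add_sub_mul_mem_span p hp1 a b n)
  exact tendsto_nhds_unique (tendsto_approxPow p hp1 (a + b)) h2

/-- `padicExp 0 = 1`. -/
theorem padicExp_zero (hp1 : Odd p) : padicExp p 0 = 1 := by
  have h := padicExp_add p hp1 0 0
  rw [add_zero] at h
  have hu := isUnit_padicExp p hp1 0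
  have : padicExp p 0 * padicExp p 0 = 1 * padicExp p 0 := by rw [← h, one_mul]
  exact mul_right_cancel₀ hu.ne_zero this

end Limit

section Injective

variable (p : ℕ) [hp : Fact p.Prime]

/-- A non-zero `a ∈ ℤ_p` lies outside some `pⁿℤ_p` (`⋂ₙ pⁿℤ_p = 0`). -/
theorem exists_not_mem_span_of_ne_zero {a : ℤ_[p]} (ha : a ≠ 0) :
    ∃ n : ℕ, a ∉ Ideal.span {(p : ℤ_[p]) ^ n} := by
  by_contra h
  apply ha
  have h1 : ∀ n : ℕ, ‖a‖ ≤ (p : ℝ) ^ (-(n : ℤ)) := fun n =>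
    norm_le_of_mem_span p (not_not.mp fun hn => h ⟨n, hn⟩)
  have h0 : ‖a‖ ≤ 0 := ge_of_tendsto' (tendsto_pow_neg p) h1
  exact norm_eq_zero.mp (le_antisymm h0 (norm_nonneg a))

/-- A non-zero `a` has an exact valuation `m`: `a ∈ pᵐℤ_p`, `a ∉ pᵐ⁺¹ℤ_p`. -/
theorem exists_mem_span_not_mem_span_succ {a : ℤ_[p]} (ha : a ≠ 0) :
    ∃ m : ℕ, a ∈ Ideal.span {(p : ℤ_[p]) ^ m} ∧ a ∉ Ideal.span {(p : ℤ_[p]) ^ (m + 1)} := by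
  classical
  have hex := exists_not_mem_span_of_ne_zero p ha
  have hN := Nat.find_spec hex
  have hmin : ∀ k < Nat.find hex, a ∈ Ideal.span {(p : ℤ_[p]) ^ k} := fun k hk =>
    not_not.mp (Nat.find_min hex hk)
  rcases hN' : Nat.find hex with _ | m
  · exfalso
    rw [hN', pow_zero, Ideal.span_singleton_one] at hN
    exact hN Submodule.mem_top
  · exact ⟨m, hmin m (by omega), hN' ▸ hN⟩

/-- For `n ≥ m`, `a ∈ pᵐℤ_p ⇒ pᵐ ∣ appr a n`. -/
theorem pow_dvd_appr_of_mem_span {a : ℤ_[p]} {m n : ℕ} (hmn : m ≤ n)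
    (h : a ∈ Ideal.span {(p : ℤ_[p]) ^ m}) : p ^ m ∣ a.appr n := by
  apply nat_dvd_of_mem_span p
  have h1 : (a.appr n : ℤ_[p]) = a - (a - a.appr n) := by ring
  rw [h1]
  exact Ideal.sub_mem _ h (span_pow_le_span_pow p hmn (PadicInt.appr_spec n a))

/-- For `n ≥ m + 1`, `a ∉ pᵐ⁺¹ℤ_p ⇒ pᵐ⁺¹ ∤ appr a n`. -/
theorem not_pow_dvd_appr_of_not_mem_span {a : ℤ_[p]} {m n : ℕ} (hmn : m + 1 ≤ n)
    (h : a ∉ Ideal.span {(p : ℤ_[p]) ^ (m + 1)}) : ¬ p ^ (m + 1) ∣ a.appr n := by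
  intro hd
  apply h
  have h1 : a = (a.appr n : ℤ_[p]) + (a - a.appr n) := by ring
  rw [h1]
  exact Ideal.add_mem _ (mem_span_of_nat_dvd p hd)
    (span_pow_le_span_pow p hmn (PadicInt.appr_spec n a))

/-- Lifting the exponent at `α = 1 + p`: if `v_p(k) = m` then `v_p((1 + p) ^ k − 1) = m + 1`,
so `p ^ (m+2) ∤ (1 + p) ^ k − 1`. -/
theorem not_pow_dvd_pow_sub_one (hp1 : Odd p) {k m : ℕ} (h1 : p ^ m ∣ k)
    (h2 : ¬ p ^ (m + 1) ∣ k) : ¬ (p : ℤ_[p]) ^ (m + 2) ∣ (1 + p : ℤ_[p]) ^ k - 1 := by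
  have hmul : emultiplicity p k = m := emultiplicity_eq_coe.mpr ⟨h1, h2⟩
  have hv := emultiplicity_pow_sub_pow p hp1 (dvd_one_add_prime_sub_one p)
    (not_dvd_of_dvd_sub_one p (dvd_one_add_prime_sub_one p)) k
  rw [one_pow, emultiplicity_one_add_prime_sub_one p, hmul] at hv
  intro hd
  have hle := le_emultiplicity_of_pow_dvd hd
  rw [hv] at hle
  have : m + 2 ≤ 1 + m := by exact_mod_cast hle
  omega

/-- `padicExp a ≠ 1` for `a ≠ 0`: with `v_p(a) = m`, `padicExp a ≢ 1 (mod p ^ (m+2))`. -/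
theorem padicExp_ne_one_of_ne_zero (hp1 : Odd p) {a : ℤ_[p]} (ha : a ≠ 0) :
    padicExp p a ≠ 1 := by
  obtain ⟨m, hm1, hm2⟩ := exists_mem_span_not_mem_span_succ p ha
  intro h1
  have hA : approxPow p a (m + 1) - 1 ∈ Ideal.span {(p : ℤ_[p]) ^ (m + 2)} := by
    have h := padicExp_sub_approxPow_mem_span p hp1 a (m + 1)
    rw [h1] at h
    have h' := neg_mem h
    rwa [neg_sub] at h'
  rw [Ideal.mem_span_singleton] at hA
  exact not_pow_dvd_pow_sub_one p hp1 (pow_dvd_appr_of_mem_span p (by omega) hm1)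
    (not_pow_dvd_appr_of_not_mem_span p le_rfl hm2) hA

/-- `padicExp` is injective. -/
theorem padicExp_injective (hp1 : Odd p) : Function.Injective (padicExp p) := by
  intro a b hab
  by_contra hne
  have hd : a - b ≠ 0 := sub_ne_zero.mpr hne
  apply padicExp_ne_one_of_ne_zero p hp1 hd
  have h := padicExp_add p hp1 (a - b) b
  rw [sub_add_cancel, hab] at h
  have hu := isUnit_padicExp p hp1 b
  have : padicExp p (a - b) * padicExp p b = 1 * padicExp p b := by rw [← h, one_mul]
  exact mul_right_cancel₀ hu.ne_zero this

end Injective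

end Summit.Ventures.HodgeRepro.T3.PadicExpLimit
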